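import Literature.NumberTheory.NumberFields.HilbertClassFieldArtinEquivariance
import Literature.NumberTheory.NumberFields.HilbertClassFieldOfGaloisExtension
import Mathlib.RingTheory.RootsOfUnity.PrimitiveRoots
import HarnessLib

/-!
# Leopoldt's reflection theorem (isotypic form) — I: the Galois action on the Hilbert class field,
# eigencharacters of eigenfunctionals, eigenclasses of radicals
# (Washington, *Cyclotomic Fields*, §10.2, proof of Thm. 10.9; Lang, *Cyclotomic Fields I and II*, Ch. 13 §2, Thm. 2.1)

Topic `NumberTheory/NumberFields`; namespace `Literature.NumberTheory.NumberFields` (sub-namespaces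
`hilbertClassField`, `KummerRank` as the files being extended).  Theorem-only file (no definition, no named fact,
no `sorry`), unconditional.  Written by the prover seat `bsd-potss-rkm` g41 (cell `bsd-potss`, `--supports`
stmt-BirchSwinnertonDyer-19196): the three book-keeping steps of Washington's proof of the reflection theorem
(Thm. 10.9: "`G` acts on `Gal(L/K)` by conjugation … `Gal(L/K) ≃ A/A^p` as `G`-modules (Artin) … Kummer pairing
`⟨σ_g, b^g⟩ = ⟨σ, b⟩^g` … `b ↦ Cl(𝔟)`, `(b) = 𝔟^p`") on the tree's objects — the Hilbert class field
`hilbertClassField K ⊆ K̄` with its EQUIVARIANT Artin isomorphism (`HilbertClassFieldArtinEquivariance.lean`)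
and Galois descent (`HilbertClassFieldOfGaloisExtension.lean`):

* §1 `hilbertClassField.exists_ringEquiv_restrict` — every `σ ∈ Gal(K/F)` extends to a ring automorphism `e`
  of `H`; `hilbertClassField.artinEquiv_smul_inv_eq_conj` — `artinEquiv (σ⁻¹ • c) = e⁻¹ ∘ artinEquiv c ∘ e`.
* §2 `hilbertClassField.exists_character_of_addMonoidHom` — an injective map `μ ↦ χ_μ = ζ^{μ ∘ artinEquiv⁻¹}`
  from additive `μ : Cl_K → ℤ/p` to characters of `Gal(H/K)` killed by `p`, carrying `μ(σ⁻¹ • x) = n μ(x)` to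
  `χ_μ(e⁻¹τe) = χ_μ(τ)^n`.
* §3 `KummerRank.mulEquiv_mk0_eq_pow_of_map_eq` — `σ • [𝔟] = [𝔟]^m` when `(β) = 𝔟^p` and `σ(β) = x^p β^m`.

The theorem itself is `LeopoldtReflectionIsotypic.lean`.

## References

* L. C. Washington, *Introduction to Cyclotomic Fields*, 2nd ed., GTM 83 (1997), §10.2, Thm. 10.9 (proof),
  Thm. 10.11. [Washington1997]
* S. Lang, *Cyclotomic Fields I and II*, GTM 121 (1990), Ch. 13 §2, Thm. 2.1 (proof). [Lang1990]
* J. Neukirch, *Algebraic Number Theory* (1999), Ch. I §3 Thm. (3.3); Ch. IV §6; Ch. VI §7 Thm. (7.1). [NeukirchANT1999]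
-/

noncomputable section

open NumberField NumberField.IsCMField IsDedekindDomain Module IntermediateField
open scoped nonZeroDivisors

namespace Literature.NumberTheory.NumberFields

section IdealLemmas

/-- `I ^ n = J ^ n` with `n ≠ 0` forces `I = J` for ideals of a Dedekind domain (private copy of the helper of
`KummerPlusMinusRankRadical.lean`). [cite: NeukirchANT1999, Ch. I §3 Thm. (3.3)] -/
private theorem ideal_eq_of_pow_eq_pow_of_ne_zero₃ {R : Type*} [CommRing R] [IsDedekindDomain R]
    {I J : Ideal R} {n : ℕ} (hn : n ≠ 0) (h : I ^ n = J ^ n) : I = J := by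
  classical
  have hzero : ∀ {I J : Ideal R}, I ^ n = J ^ n → I = ⊥ → J = ⊥ := by
    intro I J h hI
    rw [hI, ← Ideal.zero_eq_bot, zero_pow hn] at h
    rw [← Ideal.zero_eq_bot]
    exact pow_eq_zero_iff hn |>.mp h.symm
  by_cases hI : I = ⊥
  · rw [hI, hzero h hI]
  by_cases hJ : J = ⊥
  · exact absurd (hzero h.symm hJ) hI
  have hf := congrArg UniqueFactorizationMonoid.normalizedFactors h
  rw [UniqueFactorizationMonoid.normalizedFactors_pow,
    UniqueFactorizationMonoid.normalizedFactors_pow] at hf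
  have hf' : UniqueFactorizationMonoid.normalizedFactors I =
      UniqueFactorizationMonoid.normalizedFactors J := by
    ext q
    have := congrArg (Multiset.count q) hf
    simp only [Multiset.count_nsmul] at this
    exact Nat.eq_of_mul_eq_mul_left (Nat.pos_of_ne_zero hn) this
  rw [← Ideal.prod_normalizedFactors_eq_self hI, ← Ideal.prod_normalizedFactors_eq_self hJ, hf']

end IdealLemmas

/-! ### §1. Automorphisms of the base act on the Hilbert class field and on `Gal(H/K)` -/

section GaloisAction

variable (F K : Type) [Field F] [NumberField F] [Field K] [NumberField K] [Algebra F K] [IsGalois F K]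

/-- **Every `σ ∈ Gal(K/F)` extends to a ring automorphism `e` of the Hilbert class field `H` of `K`** (`H/F` is
Galois: `σ` lifts to `K̄` and the lift stabilises `H`, tree `hilbertClassField.map_algEquiv_le`).
[cite: Washington1997, §10.2, Thm. 10.9 (proof: "`G` acts on `Gal(L/K)`")] [cite: NeukirchANT1999, Ch. VI §7 Thm. (7.1)] -/
theorem hilbertClassField.exists_ringEquiv_restrict (σ : K ≃ₐ[F] K) :
    ∃ e : hilbertClassField K ≃+* hilbertClassField K,
      ∀ k : K, e (algebraMap K (hilbertClassField K) k) = algebraMap K (hilbertClassField K) (σ k) := by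
  haveI : FiniteDimensional F K := Module.Finite.of_restrictScalars_finite ℚ F K
  haveI : IsAlgClosure F (AlgebraicClosure K) := inferInstance
  let s : AlgebraicClosure K ≃ₐ[F] AlgebraicClosure K := σ.liftNormal (AlgebraicClosure K)
  have hs : ∀ k : K, s (algebraMap K (AlgebraicClosure K) k) = algebraMap K (AlgebraicClosure K) (σ k) :=
    fun k => AlgEquiv.liftNormal_commutes σ (AlgebraicClosure K) k
  have hmem : ∀ (t : AlgebraicClosure K ≃ₐ[F] AlgebraicClosure K) {y : AlgebraicClosure K},
      y ∈ hilbertClassField K → t y ∈ hilbertClassField K := by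
    intro t y hy
    have h := hilbertClassField.map_algEquiv_le K t
    have hy' : t y ∈ ((hilbertClassField K).restrictScalars F).map
        (t : AlgebraicClosure K →ₐ[F] AlgebraicClosure K) :=
      (_root_.IntermediateField.mem_map _).mpr ⟨y, (IntermediateField.mem_restrictScalars F).mpr hy, rfl⟩
    exact (IntermediateField.mem_restrictScalars F).mp (h hy')
  let e : hilbertClassField K ≃+* hilbertClassField K :=
    { toFun := fun x => ⟨s x, hmem s x.2⟩,
      invFun := fun y => ⟨s.symm y, hmem s.symm y.2⟩,
      left_inv := fun x => Subtype.ext (s.symm_apply_apply x),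
      right_inv := fun y => Subtype.ext (s.apply_symm_apply y),
      map_mul' := fun x y => Subtype.ext (by
        change s ((x : AlgebraicClosure K) * y) = s x * s y
        exact map_mul s _ _),
      map_add' := fun x y => Subtype.ext (by
        change s ((x : AlgebraicClosure K) + y) = s x + s y
        exact map_add s _ _) }
  refine ⟨e, fun k => ?_⟩
  apply Subtype.ext
  change s (algebraMap K (AlgebraicClosure K) k) = algebraMap K (AlgebraicClosure K) (σ k)
  exact hs k

omit [NumberField F] [IsGalois F K] in
/-- **Artin equivariance in conjugation form**: for `σ ∈ Gal(K/F)` with an extension `e` to `H`, and the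
conjugation `conj τ = e⁻¹ τ e` of `Gal(H/K)`, one has `artinEquiv (σ⁻¹ • c) = e⁻¹ ∘ artinEquiv c ∘ e`
(the tree's `hilbertClassField.artinEquiv_mulEquiv_intAut_apply` for the automorphism `e⁻¹` over `σ⁻¹`).
[cite: NeukirchANT1999, Ch. IV §6 and Ch. VI §7 Thm. (7.1)] [cite: Washington1997, §10.2, Thm. 10.9 (proof)] -/
theorem hilbertClassField.artinEquiv_smul_inv_eq_conj (σ : K ≃ₐ[F] K)
    (e : hilbertClassField K ≃+* hilbertClassField K)
    (he : ∀ k : K, e (algebraMap K (hilbertClassField K) k) = algebraMap K (hilbertClassField K) (σ k))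
    (conj : (hilbertClassField K ≃ₐ[K] hilbertClassField K) → (hilbertClassField K ≃ₐ[K] hilbertClassField K))
    (hconj : ∀ (τ : hilbertClassField K ≃ₐ[K] hilbertClassField K) (y : hilbertClassField K),
      conj τ y = e.symm (τ (e y)))
    (c : ClassGroup (𝓞 K)) :
    hilbertClassField.artinEquiv K (ClassGroup.mulEquiv (AmbiguousClass.intAut σ⁻¹) c) =
      conj (hilbertClassField.artinEquiv K c) := by
  -- `e⁻¹` as a `ℚ`-algebra automorphism of `H`, restricting to `σ⁻¹`
  have he' : ∀ k : K, e.symm (algebraMap K (hilbertClassField K) k) =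
      algebraMap K (hilbertClassField K) (σ⁻¹ k) := by
    intro k
    apply e.injective
    rw [RingEquiv.apply_symm_apply, he, AlgEquiv.aut_inv, AlgEquiv.apply_symm_apply]
  let t : hilbertClassField K ≃ₐ[ℚ] hilbertClassField K :=
    AlgEquiv.ofRingEquiv (f := e.symm) fun q => by
      rw [eq_ratCast (algebraMap ℚ (hilbertClassField K)) q, map_ratCast]
  have ht : ∀ k : K, t (algebraMap K (hilbertClassField K) k) =
      algebraMap K (hilbertClassField K) (σ⁻¹ k) := he'
  apply AlgEquiv.ext
  intro y
  rw [hilbertClassField.artinEquiv_mulEquiv_intAut_apply K t σ⁻¹ ht c y, hconj]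
  rfl

end GaloisAction

/-! ### §2. Eigenfunctionals on `Cl_K` ↦ eigencharacters of `Gal(H/K)` -/

section Characters

variable (F K : Type) [Field F] [NumberField F] [Field K] [NumberField K] [Algebra F K] [IsGalois F K]

omit [NumberField F] [IsGalois F K] in
/-- **From a `ψ`-eigenfunctional to a `ψ`-eigencharacter of `Gal(H/K)`.**  For `ζ ∈ K` a primitive `p`-th root of
unity there is an injective map `μ ↦ χ_μ` from additive maps `Cl_K → ℤ/p` to characters `Gal(H/K) → K^×` killed
by `p`, `χ_μ(τ) = ζ^{μ(artinEquiv⁻¹ τ)}`, carrying the eigen-relation `μ(σ⁻¹ • x) = n μ(x)` to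
`χ_μ(e_σ⁻¹ τ e_σ) = χ_μ(τ)^n` (Artin equivariance). [cite: Washington1997, §10.2, Thm. 10.9 (proof:
"`Gal(L/K) ≃ A/A^p` … `ε_i(A/pA)` corresponds to `ε_i Gal(L/K)`")] -/
theorem hilbertClassField.exists_character_of_addMonoidHom {p : ℕ} (hp : p.Prime) {ζ : K}
    (hζ : IsPrimitiveRoot ζ p) :
    ∃ X : (Additive (ClassGroup (𝓞 K)) →+ ZMod p) →
        ((hilbertClassField K ≃ₐ[K] hilbertClassField K) →* Kˣ),
      Function.Injective X ∧
      (∀ μ τ, X μ τ ^ p = 1) ∧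
      ∀ (μ : Additive (ClassGroup (𝓞 K)) →+ ZMod p) (σ : K ≃ₐ[F] K) (n : ℕ)
        (e : hilbertClassField K ≃+* hilbertClassField K)
        (_he : ∀ k : K, e (algebraMap K (hilbertClassField K) k) = algebraMap K (hilbertClassField K) (σ k))
        (conj : (hilbertClassField K ≃ₐ[K] hilbertClassField K) →
          (hilbertClassField K ≃ₐ[K] hilbertClassField K))
        (_hconj : ∀ (τ : hilbertClassField K ≃ₐ[K] hilbertClassField K) (y : hilbertClassField K),
          conj τ y = e.symm (τ (e y))),
        (∀ c : ClassGroup (𝓞 K),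
          μ (Additive.ofMul (ClassGroup.mulEquiv (AmbiguousClass.intAut σ⁻¹) c)) =
            (n : ZMod p) * μ (Additive.ofMul c)) →
        ∀ τ, X μ (conj τ) = X μ τ ^ n := by
  classical
  haveI : Fact p.Prime := ⟨hp⟩
  haveI : NeZero p := ⟨hp.ne_zero⟩
  -- `ζ` as a unit, the logarithm `ℤ/p ≅ ⟨ζ⟩`
  let ζu : Kˣ := (hζ.isUnit hp.ne_zero).unit
  have hζu : IsPrimitiveRoot ζu p := IsPrimitiveRoot.coe_units_iff.mp (by
    rw [IsUnit.unit_spec]; exact hζ)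
  let L : ZMod p ≃+ Additive (Subgroup.zpowers ζu) := hζu.zmodEquivZPowers
  let art : Additive (hilbertClassField K ≃ₐ[K] hilbertClassField K) →+ Additive (ClassGroup (𝓞 K)) :=
    MonoidHom.toAdditive (hilbertClassField.artinEquiv K).symm.toMonoidHom
  let X : (Additive (ClassGroup (𝓞 K)) →+ ZMod p) →
      ((hilbertClassField K ≃ₐ[K] hilbertClassField K) →* Kˣ) := fun μ =>
    (Subgroup.zpowers ζu).subtype.comp (MonoidHom.toAdditive.symm (L.toAddMonoidHom.comp (μ.comp art)))
  have hX : ∀ μ τ, X μ τ = ((Additive.toMul (L (μ (Additive.ofMul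
      ((hilbertClassField.artinEquiv K).symm τ)))) : Subgroup.zpowers ζu) : Kˣ) := fun μ τ => rfl
  refine ⟨X, ?_, ?_, ?_⟩
  · -- injective
    intro μ ν h
    ext x
    obtain ⟨c, rfl⟩ : ∃ c : ClassGroup (𝓞 K), Additive.ofMul c = x := ⟨Additive.toMul x, rfl⟩
    have h1 := congrArg (fun χ : (hilbertClassField K ≃ₐ[K] hilbertClassField K) →* Kˣ =>
      χ (hilbertClassField.artinEquiv K c)) h
    simp only [hX, MulEquiv.symm_apply_apply] at h1
    exact L.injective (Additive.toMul.injective (Subtype.ext h1))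
  · -- killed by `p`
    intro μ τ
    rw [hX]
    obtain ⟨k, hk⟩ := (Subgroup.mem_zpowers_iff).mp
      (Additive.toMul (L (μ (Additive.ofMul ((hilbertClassField.artinEquiv K).symm τ))))).2
    rw [← hk, ← zpow_natCast, ← zpow_mul, mul_comm, zpow_mul, zpow_natCast, hζu.pow_eq_one, one_zpow]
  · -- eigen-relation
    intro μ σ n e he conj hconj hμ τ
    have hart := hilbertClassField.artinEquiv_smul_inv_eq_conj F K σ e he conj hconj
      ((hilbertClassField.artinEquiv K).symm τ)
    rw [MulEquiv.apply_symm_apply] at hart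
    rw [hX, hX, ← hart, MulEquiv.symm_apply_apply, hμ, ← nsmul_eq_mul, map_nsmul, toMul_nsmul,
      Subgroup.coe_pow]

end Characters

/-! ### §3. The eigenclass of a radical -/

section Eigenclass

variable {F : Type} (K : Type) [Field F] [Field K] [NumberField K] [Algebra F K]

/-- **`σ • [𝔟] = [𝔟]^m` when `(β) = 𝔟^p` and `σ(β) = x^p β^m`** (`x ∈ K`): writing `x = n/d` with `n, d ∈ 𝓞_K`,
`((d) σ𝔟)^p = ((n) 𝔟^m)^p`, so `(d) σ𝔟 = (n) 𝔟^m` by unique factorisation ("`b ↦ Cl(𝔟)` … `φ⁻ : V⁻ → C_p⁻`"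
is `G`-equivariant). [cite: Washington1997, §10.2, Thm. 10.9 (proof)] [cite: Lang1990, Ch. 13 §2, Thm. 2.1 (proof)] -/
theorem KummerRank.mulEquiv_mk0_eq_pow_of_map_eq {p : ℕ} (hp : p.Prime) (σ : K ≃ₐ[F] K) {β : 𝓞 K}
    (hβ0 : β ≠ 0) {𝔟 : Ideal (𝓞 K)} (h𝔟mem : 𝔟 ∈ (Ideal (𝓞 K))⁰) (h𝔟 : Ideal.span {β} = 𝔟 ^ p)
    {x : K} {m : ℕ} (hσβ : σ (β : K) = x ^ p * (β : K) ^ m) :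
    ClassGroup.mulEquiv (AmbiguousClass.intAut σ) (ClassGroup.mk0 ⟨𝔟, h𝔟mem⟩) =
      ClassGroup.mk0 ⟨𝔟, h𝔟mem⟩ ^ m := by
  classical
  obtain ⟨n, d, hd, hnd⟩ := IsFractionRing.div_surjective (A := 𝓞 K) x
  have hd0 : (d : 𝓞 K) ≠ 0 := nonZeroDivisors.ne_zero hd
  have hdK : ((d : 𝓞 K) : K) ≠ 0 := RingOfIntegers.coe_ne_zero_iff.mpr hd0
  -- `d^p σ(β) = n^p β^m` in `𝓞 K`
  have hrel : d ^ p * AmbiguousClass.intAut σ β = n ^ p * β ^ m := by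
    apply RingOfIntegers.ext
    simp only [map_mul, map_pow]
    change ((d : 𝓞 K) : K) ^ p * σ (β : K) = ((n : 𝓞 K) : K) ^ p * (β : K) ^ m
    rw [hσβ, ← hnd, div_pow, ← mul_assoc, mul_div_cancel₀ _ (pow_ne_zero _ hdK)]
  have hn0 : n ≠ 0 := by
    intro hn0
    rw [hn0, zero_pow hp.ne_zero, zero_mul, mul_eq_zero] at hrel
    rcases hrel with h | h
    · exact hd0 (pow_eq_zero_iff hp.ne_zero |>.mp h)
    · exact hβ0 ((AmbiguousClass.intAut σ).map_eq_zero_iff.mp h)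
  have h𝔟σ : Ideal.span {AmbiguousClass.intAut σ β} =
      (𝔟.map (AmbiguousClass.intAut σ : 𝓞 K →+* 𝓞 K)) ^ p := by
    have := congrArg (Ideal.map (AmbiguousClass.intAut σ : 𝓞 K →+* 𝓞 K)) h𝔟
    rwa [Ideal.map_span, Set.image_singleton, Ideal.map_pow] at this
  have hI : (Ideal.span {d} * 𝔟.map (AmbiguousClass.intAut σ : 𝓞 K →+* 𝓞 K)) ^ p =
      (Ideal.span {n} * 𝔟 ^ m) ^ p := by
    rw [mul_pow, mul_pow, ← h𝔟σ, ← pow_mul, mul_comm m p, pow_mul, ← h𝔟, Ideal.span_singleton_pow,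
      Ideal.span_singleton_pow, Ideal.span_singleton_pow, Ideal.span_singleton_mul_span_singleton,
      Ideal.span_singleton_mul_span_singleton, hrel]
  have hI' : Ideal.span {d} * 𝔟.map (AmbiguousClass.intAut σ : 𝓞 K →+* 𝓞 K) =
      Ideal.span {n} * 𝔟 ^ m :=
    ideal_eq_of_pow_eq_pow_of_ne_zero₃ hp.ne_zero hI
  have hdmem : Ideal.span {d} ∈ (Ideal (𝓞 K))⁰ := by
    refine mem_nonZeroDivisors_of_ne_zero ?_
    rw [Ne, Submodule.zero_eq_bot, Ideal.span_singleton_eq_bot]; exact hd0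
  have hnmem : Ideal.span {n} ∈ (Ideal (𝓞 K))⁰ := by
    refine mem_nonZeroDivisors_of_ne_zero ?_
    rw [Ne, Submodule.zero_eq_bot, Ideal.span_singleton_eq_bot]; exact hn0
  have h1 : ClassGroup.mk0 ⟨Ideal.span {d}, hdmem⟩ = 1 :=
    (ClassGroup.mk0_eq_one_iff hdmem).mpr ⟨⟨d, rfl⟩⟩
  have h2 : ClassGroup.mk0 ⟨Ideal.span {n}, hnmem⟩ = 1 :=
    (ClassGroup.mk0_eq_one_iff hnmem).mpr ⟨⟨n, rfl⟩⟩
  have h3 : ClassGroup.mk0 (⟨Ideal.span {d}, hdmem⟩ *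
        ⟨_, AmbiguousClass.map_mem_nonZeroDivisors σ ⟨𝔟, h𝔟mem⟩⟩) =
      ClassGroup.mk0 (⟨Ideal.span {n}, hnmem⟩ * ⟨𝔟, h𝔟mem⟩ ^ m) := by
    congr 1
    exact Subtype.ext hI'
  rw [map_mul, map_mul, map_pow, h1, h2, one_mul, one_mul] at h3
  rw [AmbiguousClass.mulEquiv_mk0]
  exact h3

end Eigenclass

end Literature.NumberTheory.NumberFields

end
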